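import Summits.BirchSwinnertonDyer.BirchSwinnertonDyer.Theorems.AlignedTransportAtTwoMainConjectureOfRankZeroBSDAtTwoKatoMuRoad
import HarnessLib

/-!
# Route `AlignedTransportAtTwo`, crux C2 `MainConjectureOfRankZeroBSDAtTwo` (stmt-BirchSwinnertonDyer-22298), ROAD (c) in
# `μ`-currency: the `2`-adic main conjecture of a `BSD₂`-certified rank-`0` seed IS `μ^{alg} = μ^{an}`; `μ^{an} ≤ μ^{alg}` is PRINT

HONEST FRAMING (cell `bsd-f1-sign2`, lead prover seat `bsd-line-att-p2` gen 3, line `birth`; BSD is NOT proved by any of this;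
no theorem beyond print). THEOREMS ONLY — no definition, nothing asserted; the deep inputs are DISPLAYED hypotheses which are
PUBLISHED named facts of the tree (`h17` Kato 2004 Thm. 17.4 (1)(2) at `2`, `hGr` Greenberg 1999 Thm. 4.1 parity-free, `hper`
the period unit at `2`, `hmod` modularity, `hGZK` Gross–Zagier–Kolyvagin). Sequel of `…KatoMuRoad` (p597991/p598291: C2 ⟺
the seed-cell `𝔭 = (2)` clause `X5.O1.KatoMuPartAtTwo`; per curve `MazurMainConjecture W 2 ⟺ X5.O1.KatoMuPartAtTwo W`).

References: K. Kato, Astérisque 295 (2004), Thm. 13.4 (3) p. 226, Thm. 17.4 p. 273; R. Greenberg, LNM 1716 (1999), Thm. 4.1,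
Conj. 1.11; D. Rohrlich, Invent. Math. 75 (1984); R. L. Miller, LMS J. Comput. Math. 14 (2011), Def. 1.1.
-/

set_option linter.dupNamespace false
set_option autoImplicit false

noncomputable section

open scoped Classical MatrixGroups ModularForm

open CongruenceSubgroup WeierstrassCurve Literature.NumberTheory.EllipticCurves
  Literature.NumberTheory.EllipticCurves.ModularForms
  Literature.NumberTheory.EllipticCurves.Rank1Residual
  Literature.NumberTheory.EllipticCurves.Greenberg1999
  Summit.BirchSwinnertonDyer.Rank1Residual
  Summit.BirchSwinnertonDyer.Rank1Residual.X1.MuLambda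
  Summit.BirchSwinnertonDyer.Rank1Residual.X1.MuPart
  Summit.BirchSwinnertonDyer.Rank1Residual.X5
  Summit.BirchSwinnertonDyer.Rank1Residual.F1Sign2
  Summit.BirchSwinnertonDyer.BirchSwinnertonDyer.Theorems.Rank1ResidualX1Defs
  Summit.BirchSwinnertonDyer.BirchSwinnertonDyer.Theses.AlignedTransportAtTwo
  Summit.BirchSwinnertonDyer.BirchSwinnertonDyer.Theorems.AlignedTransportAtTwoSeed

namespace Summit.BirchSwinnertonDyer.BirchSwinnertonDyer.Theorems.AlignedTransportAtTwoKatoMuRoad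

/-! ## §4 `μ`-currency: on the rank-`0` `BSD₂` cell `μ^{an} ≤ μ^{alg}` is PRINT, and the main conjecture IS `μ^{alg} = μ^{an}`

Write `μ^{alg} = μ(X(W/ℚ_∞)) = D.mu` and `μ^{an} = μ(L₀)` for a Néron-integral lift `ι L₀ = ϖ·L₂(f, α)` of the conductor-level
newform. The `𝔭 = (2)` clause `X5.O1.KatoMuPartAtTwo W` is the inequality `μ^{alg} ≤ μ^{an}` (§4.1). The OPPOSITE inequality
`μ^{an} ≤ μ^{alg}` is a theorem of the printed record on the rank-`0` `BSD₂` cell (§4.2: cell `bsd-2adic`'s reading (i) of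
Kato 17.4 (1)(2) + Greenberg 4.1, `EisensteinShaCurrency.sha_readings_of_kato` — «`ord₂ #Ш − ord₂ #Ш_an ≤ μ(X) − μ(L₀)`» —
with `BSD(W,2)` killing the `Ш`-excess). Hence (§4.3) on that cell `MazurMainConjecture W 2 ⟺ μ^{alg} = μ^{an}` at every
datum: the seed crux is EXACTLY the transfer of ONE inequality of `μ`-invariants across Kato's missing clause at `2`. -/

section MuCurrency

variable (W : WeierstrassCurve ℚ) [W.IsElliptic] [W.IsGloballyMinimal]

/-- **§4.1 The `𝔭 = (2)` clause in `μ`-currency**: `X5.O1.KatoMuPartAtTwo W` holds IFF `μ(X) ≤ μ(L₀)` for every cyclotomic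
datum, conductor-level newform `f`, Néron ratio `ϖ` and integral `L₀` with `ι L₀ = ϖ·L₂(f, α)` (`L₀ ≠ 0` by Rohrlich, so
`2^{μ(X)} ∣ L₀ ⟺ μ(X) ≤ μ(L₀)` by maximality of `μ`). [cite: Kato2004Asterisque, Thm. 13.4 (3) (p. 226) (shape)]
[cite: RohrlichInventiones1984, Theorem (p. 409)] -/
theorem katoMuPartAtTwo_iff_forall_mu_le :
    O1.KatoMuPartAtTwo W ↔
      ∀ (κ : ZpExtension ℚ 2) (γ : Field.absoluteGaloisGroup ℚ),
          κ.IsCyclotomic → κ.IsTopGenerator γ → IsCyclotomicVariable 2 γ → IsOrdinaryAt W 2 →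
        ∀ [NeZero (W.conductorNorm ℤ)] (f : CuspForm (Gamma0 (W.conductorNorm ℤ)) 2),
          IsNewformOf W f → ∀ (ϖ : ℚ), (ϖ : ℝ) * W.realPeriodRat = plusPeriod f →
        ∀ (D : W.SelmerDualData κ γ) (L₀ : IwasawaAlgebra 2),
          iwasawaToPowerSeries 2 L₀ =
              PowerSeries.C (ϖ : ℚ_[2]) * padicLFunction f (unitRoot W 2 : ℚ_[2]) →
          D.mu ≤ mu L₀ := by
  refine ⟨fun hK κ γ hκ hγ hγ' hord _ f hf ϖ hϖ D L₀ hL₀ => ?_,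
    fun h κ γ hκ hγ hγ' hord _ f hf ϖ hϖ D L₀ hL₀ => ?_⟩
  · have hL₀0 : L₀ ≠ 0 := EisensteinShaCurrency.ne_zero_of_iwasawaToPowerSeries_eq W hord hf
      (X2.varpi_ne_zero_of_isNewformOf hf hϖ) hL₀
    exact le_mu_of_C_pow_dvd hL₀0 (hK κ γ hκ hγ hγ' hord f hf ϖ hϖ D L₀ hL₀)
  · have hL₀0 : L₀ ≠ 0 := EisensteinShaCurrency.ne_zero_of_iwasawaToPowerSeries_eq W hord hf
      (X2.varpi_ne_zero_of_isNewformOf hf hϖ) hL₀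
    exact (map_dvd (PowerSeries.C (R := ℤ_[2]))
      (pow_dvd_pow (2 : ℤ_[2]) (h κ γ hκ hγ hγ' hord f hf ϖ hϖ D L₀ hL₀))).trans (C_pow_mu_dvd hL₀0)

/-- **§4.2 `μ^{an} ≤ μ^{alg}` is PRINT on the rank-`0` `BSD₂` cell.** `W` good ordinary at `2`, `r_an = 0`, `BSD(W,2)`;
granted Kato 17.4 (1)(2) at `2` for `W` (`h17`), Greenberg 4.1 (`hGr`), modularity (`hmod`), GZK (`hGZK`): for every
cyclotomic datum `D`, conductor-level newform `f`, Néron ratio `ϖ` and integral `L₀` with `ι L₀ = ϖ·L₂(f, α)`: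
`μ(L₀) ≤ μ(X)`. Proof: reading (i) of `EisensteinShaCurrency.sha_readings_of_kato` (with `ϖ′ = ϖ`) is
`ord₂ #Ш + μ(L₀) ≤ ord₂ #Ш_an + μ(X)`, and `BSD(W,2)` gives `ord₂ #Ш_an = ord₂ #Ш`. No period unit, no `E[2]`
hypothesis, no analytic binder. [cite: Kato2004Asterisque, Thm. 17.4 (1)(2) (p. 273)] [cite: GreenbergLNM1716, Thm. 4.1 (p. 102)]
[cite: Miller2011LMS, Def. 1.1] -/
theorem mu_lift_le_mu_of_bsdp
    (h17 : ∀ [NeZero (W.conductorNorm ℤ)] (f : CuspForm (Gamma0 (W.conductorNorm ℤ)) 2),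
      kato_divisibility_allPrimes W 2 (f := f))
    (hGr : Greenberg1999.thm41_charValue_rankZero_anyPrime) (hmod : nonempty_modularParametrizationData)
    (hGZK : rank_eq_analyticRank_of_analyticRank_le_one) (hord : IsOrdinaryAt W 2) (hr : W.analyticRank = 0)
    (hbsd : BSDp W 2) :
    ∀ (κ : ZpExtension ℚ 2) (γ : Field.absoluteGaloisGroup ℚ),
        κ.IsCyclotomic → κ.IsTopGenerator γ → IsCyclotomicVariable 2 γ →
      ∀ [NeZero (W.conductorNorm ℤ)] (f : CuspForm (Gamma0 (W.conductorNorm ℤ)) 2),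
        IsNewformOf W f → ∀ (ϖ : ℚ), (ϖ : ℝ) * W.realPeriodRat = plusPeriod f →
      ∀ (D : W.SelmerDualData κ γ) (L₀ : IwasawaAlgebra 2),
        iwasawaToPowerSeries 2 L₀ =
            PowerSeries.C (ϖ : ℚ_[2]) * padicLFunction f (unitRoot W 2 : ℚ_[2]) →
        mu L₀ ≤ D.mu := by
  intro κ γ hκ hγ hγ' _ f hf ϖ hϖ D L₀ hL₀
  haveI : Module.Finite (IwasawaAlgebra 2) D.X := D.module_finite_holds hγ
  have hL : W.entireLFunction 1 ≠ 0 := entireLFunction_one_ne_zero_of_analyticRank_eq_zero hmod W hr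
  have hϖ0 : ϖ ≠ 0 := X2.varpi_ne_zero_of_isNewformOf hf hϖ
  obtain ⟨fX, hfX⟩ := (charIdeal_isPrincipal_holds 2 D.X).principal
  have hchar : D.charIdeal = Ideal.span {fX} := hfX
  obtain ⟨q, hq, hi, -, -⟩ := EisensteinShaCurrency.sha_readings_of_kato W (h17 f)
    (O1.twoAdicEulerCharRankZero_zero_of_greenberg W hGr) hGZK hord hL hκ hγ hγ' hf D hϖ hϖ0 hchar hL₀
  -- `BSD(W,2)`: `ord₂ #Ш_an = ord₂ #Ш`
  haveI : Finite W.sha := (hGZK W (by rw [hr]; exact zero_le_one)).2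
  obtain ⟨q', hq', hv⟩ := Typed.missingPPartAt_of_bsdp W 2 hbsd
  have hqq : q' = q := by exact_mod_cast hq'.symm.trans hq
  subst hqq
  have key : (mu L₀ : ℤ) ≤ D.mu := by linarith
  exact_mod_cast key

/-- **§4.3 The `2`-adic main conjecture of a `BSD₂`-certified rank-`0` seed IS `μ^{alg} = μ^{an}`.** Modulo PRINT (`h17`,
`hGr`, `hper`, `hmod`, `hGZK`), for `W` good ordinary at `2` with no rational point of order `2`, `r_an = 0` and `BSD(W,2)`:
`MazurMainConjecture W 2` IFF `μ(X) = μ(L₀)` at every cyclotomic datum and every Néron-integral lift `L₀` of the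
conductor-level `2`-adic `L`-function (§3 + §4.1 + §4.2). The route's crux C2 transfers the single inequality
`μ^{alg} ≤ μ^{an}` — Kato's missing `𝔭 = (2)` clause — and nothing else. [cite: Kato2004Asterisque, Thm. 13.4 (3) (p. 226), Thm. 17.4 (p. 273)]
[cite: GreenbergLNM1716, Thm. 4.1 (p. 102), Conj. 1.11 (p. 58)] -/
theorem mazurMainConjecture_two_iff_forall_mu_eq
    (h17 : ∀ [NeZero (W.conductorNorm ℤ)] (f : CuspForm (Gamma0 (W.conductorNorm ℤ)) 2),
      kato_divisibility_allPrimes W 2 (f := f))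
    (hGr : Greenberg1999.thm41_charValue_rankZero_anyPrime)
    (hper : realPeriodRat_eq_unit_mul_plusPeriod_two) (hmod : nonempty_modularParametrizationData)
    (hGZK : rank_eq_analyticRank_of_analyticRank_le_one) (hord : IsOrdinaryAt W 2)
    (ht : ∀ x : ℚ, ¬ HasRationalTwoTorsionX W x) (hr : W.analyticRank = 0) (hbsd : BSDp W 2) :
    MazurMainConjecture W 2 ↔
      ∀ (κ : ZpExtension ℚ 2) (γ : Field.absoluteGaloisGroup ℚ),
          κ.IsCyclotomic → κ.IsTopGenerator γ → IsCyclotomicVariable 2 γ →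
        ∀ [NeZero (W.conductorNorm ℤ)] (f : CuspForm (Gamma0 (W.conductorNorm ℤ)) 2),
          IsNewformOf W f → ∀ (ϖ : ℚ), (ϖ : ℝ) * W.realPeriodRat = plusPeriod f →
        ∀ (D : W.SelmerDualData κ γ) (L₀ : IwasawaAlgebra 2),
          iwasawaToPowerSeries 2 L₀ =
              PowerSeries.C (ϖ : ℚ_[2]) * padicLFunction f (unitRoot W 2 : ℚ_[2]) →
          D.mu = mu L₀ := by
  rw [mazurMainConjecture_two_iff_katoMuPartAtTwo W h17 hGr hper hmod hGZK hord ht hr hbsd,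
    katoMuPartAtTwo_iff_forall_mu_le W]
  refine ⟨fun h κ γ hκ hγ hγ' _ f hf ϖ hϖ D L₀ hL₀ => le_antisymm (h κ γ hκ hγ hγ' hord f hf ϖ hϖ D L₀ hL₀)
      (mu_lift_le_mu_of_bsdp W h17 hGr hmod hGZK hord hr hbsd κ γ hκ hγ hγ' f hf ϖ hϖ D L₀ hL₀),
    fun h κ γ hκ hγ hγ' _ _ f hf ϖ hϖ D L₀ hL₀ => (h κ γ hκ hγ hγ' f hf ϖ hϖ D L₀ hL₀).le⟩

end MuCurrency

end Summit.BirchSwinnertonDyer.BirchSwinnertonDyer.Theorems.AlignedTransportAtTwoKatoMuRoad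

end
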